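import Mathlib
import Summits.ResolutionOfSingularities.ResolutionOfSingularities.Theorems.ShadowGameWin.Negative.Mirror

/-!
# Orders and cleanliness of B's positions — stub `stub_orders` of line `refutation-cuspidal-edge` (crux stmt-ResolutionOfSingularities-18182, route ShadowGame)

For a position `f = x · Π^p · E^p`, `Π = x^a z^{2e} U y² − x^b W³`, `W = z − x − xz` (`U`, `E`
units of `κ⟦x,y,z⟧`), we compute the seven `F`-orders `mF F` read by the shadow game, and show
that `f` is clean (no monomial with all exponents divisible by `p`), non-zero and has no monomial
of degree `≤ 1`.  Method: `mF F` is the weighted order for the indicator weight of `F`; weighted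
orders are additive on products in the domain `κ⟦x,y,z⟧` (`MvPowerSeries.weightedOrder_mul`);
the two summands of `Π` have `y`-disjoint supports (every monomial of the first has `y`-exponent
`≥ 2`, the second is `y`-free), so the order of `Π` is the minimum of theirs; cleanliness comes
from `G ^ p = (expand p G).map frobenius` (`MvPowerSeries.map_frobenius_expand`).
-/

noncomputable section

set_option linter.dupNamespace false

namespace Summit.ResolutionOfSingularities.ResolutionOfSingularities.Theorems.ShadowGameWinR.Negative

open Summit.ResolutionOfSingularities.ResolutionOfSingularities.Theorems.ShadowGameWin.Negative (mF)
open MvPowerSeries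

variable {κ : Type} [Field κ]

/-- The `F`-order `mF` of the coefficient function of a power series is its weighted order for the
indicator weight of `F` (when the latter is finite). [folklore] -/
theorem mF_eq_of_weightedOrder_eq (F : Finset (Fin 3)) (f : MvPowerSeries (Fin 3) κ) (n : ℕ)
    (h : f.weightedOrder (fun j => if j ∈ F then 1 else 0) = n) :
    mF F (fun A : Fin 3 → ℕ => coeff (Finsupp.equivFunOnFinite.symm A) f) = n := by
  have hw : ∀ d : Fin 3 →₀ ℕ,
      Finsupp.weight (fun j => if j ∈ F then 1 else 0) d = Finset.sum F (fun j => d j) := by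
    intro d
    rw [Finsupp.weight_apply, Finsupp.sum_fintype _ _ (by simp)]
    simp only [smul_eq_mul, mul_ite, mul_one, mul_zero]
    rw [← Finset.sum_filter]
    simp
  rw [weightedOrder_eq_nat] at h
  obtain ⟨⟨d, hd, hdn⟩, hlt⟩ := h
  unfold mF
  apply le_antisymm
  · apply Nat.sInf_le
    exact ⟨⇑d, by simpa using hd, by rw [← hdn, hw]⟩
  · refine le_csInf ⟨n, ⇑d, by simpa using hd, by rw [← hdn, hw]⟩ ?_
    rintro m ⟨A, hA, rfl⟩
    by_contra hmn
    exact hA (hlt _ (by rw [hw]; simpa using not_le.mp hmn))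

/-- Weighted order of a variable. [folklore] -/
theorem weightedOrder_X_eq (w : Fin 3 → ℕ) (i : Fin 3) :
    (X i : MvPowerSeries (Fin 3) κ).weightedOrder w = w i := by
  rw [X_def, weightedOrder_monomial_of_ne_zero w one_ne_zero, Finsupp.weight_single, smul_eq_mul,
    one_mul]

/-- Weighted order of a power (in the domain `κ⟦x,y,z⟧`). [folklore] -/
theorem weightedOrder_pow_eq (w : Fin 3 → ℕ) (g : MvPowerSeries (Fin 3) κ) (n : ℕ) :
    (g ^ n).weightedOrder w = n * g.weightedOrder w := by
  induction n with
  | zero => simp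
  | succ n ih => rw [pow_succ, weightedOrder_mul, ih, Nat.cast_succ, add_mul, one_mul]

/-- A unit has weighted order `0`. [folklore] -/
theorem weightedOrder_of_isUnit (w : Fin 3 → ℕ) {u : MvPowerSeries (Fin 3) κ} (hu : IsUnit u) :
    u.weightedOrder w = 0 := by
  have h0 : coeff (0 : Fin 3 →₀ ℕ) u ≠ 0 := by
    rw [coeff_zero_eq_constantCoeff_apply]
    exact (isUnit_constantCoeff u hu).ne_zero
  exact le_antisymm (by simpa using weightedOrder_le w h0) zero_le

/-- The coefficients of `W = z − x − xz`. [folklore] -/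
theorem coeff_W (d : Fin 3 →₀ ℕ) :
    coeff d (X 2 - X 0 - X 0 * X 2 : MvPowerSeries (Fin 3) κ) =
      (if d = Finsupp.single 2 1 then 1 else 0) - (if d = Finsupp.single 0 1 then 1 else 0) -
        (if d = Finsupp.single 0 1 + Finsupp.single 2 1 then 1 else 0) := by
  classical
  rw [map_sub, map_sub, coeff_X, coeff_X, X_def, X_def, monomial_mul_monomial, coeff_monomial,
    mul_one]

/-- Weighted order of `W = z − x − xz`. [folklore] -/
theorem weightedOrder_W (w : Fin 3 → ℕ) :
    (X 2 - X 0 - X 0 * X 2 : MvPowerSeries (Fin 3) κ).weightedOrder w = min (w 0) (w 2) := by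
  apply le_antisymm
  · by_cases h : w 0 ≤ w 2
    · have hc : coeff (Finsupp.single 0 1)
          (X 2 - X 0 - X 0 * X 2 : MvPowerSeries (Fin 3) κ) ≠ 0 := by
        have h1 : (Finsupp.single 0 1 : Fin 3 →₀ ℕ) ≠ Finsupp.single 2 1 := by
          intro h; have := DFunLike.congr_fun h 0; simp at this
        have h2 : (Finsupp.single 0 1 : Fin 3 →₀ ℕ) ≠
            Finsupp.single 0 1 + Finsupp.single 2 1 := by
          intro h; have := DFunLike.congr_fun h 2; simp at this
        rw [coeff_W]
        simp [h1, h2]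
      refine (weightedOrder_le w hc).trans ?_
      rw [Finsupp.weight_single]
      simp [h]
    · have hc : coeff (Finsupp.single 2 1)
          (X 2 - X 0 - X 0 * X 2 : MvPowerSeries (Fin 3) κ) ≠ 0 := by
        have h1 : (Finsupp.single 2 1 : Fin 3 →₀ ℕ) ≠ Finsupp.single 0 1 := by
          intro h; have := DFunLike.congr_fun h 0; simp at this
        have h2 : (Finsupp.single 2 1 : Fin 3 →₀ ℕ) ≠
            Finsupp.single 0 1 + Finsupp.single 2 1 := by
          intro h; have := DFunLike.congr_fun h 0; simp at this
        rw [coeff_W]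
        simp [h1, h2]
      refine (weightedOrder_le w hc).trans ?_
      rw [Finsupp.weight_single]
      simp [(not_le.mp h).le]
  · rw [sub_eq_add_neg, sub_eq_add_neg]
    refine le_trans ?_ (min_weightedOrder_le_add w)
    refine le_min (le_trans ?_ (min_weightedOrder_le_add w)) ?_
    · rw [weightedOrder_neg, weightedOrder_X_eq, weightedOrder_X_eq]
      simp [min_comm]
    · rw [weightedOrder_neg, weightedOrder_mul, weightedOrder_X_eq, weightedOrder_X_eq]
      exact_mod_cast (min_le_left _ _).trans (Nat.le_add_right _ _)

/-- `x^b · W³` involves no `y`: its coefficients vanish at exponents `d` with `d 1 ≠ 0`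
(everything is weighted-homogeneous of weight `0` for the weight `𝟙_{1}`). [folklore] -/
theorem coeff_P2_eq_zero (b : ℕ) (d : Fin 3 →₀ ℕ) (hd : d 1 ≠ 0) :
    coeff d (X 0 ^ b * (X 2 - X 0 - X 0 * X 2) ^ 3 : MvPowerSeries (Fin 3) κ) = 0 := by
  classical
  have hmon : ∀ n : Fin 3 →₀ ℕ, n 1 = 0 →
      (monomial n (1 : κ)).IsWeightedHomogeneous (Pi.single 1 1) 0 := by
    intro n hn m hm
    rw [coeff_monomial] at hm
    by_cases h : m = n
    · rw [h, Finsupp.weight_single_one_apply, hn]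
    · exact absurd (if_neg h) hm
  have hX0 : (X 0 : MvPowerSeries (Fin 3) κ).IsWeightedHomogeneous (Pi.single 1 1) 0 :=
    hmon _ (by simp)
  have hX2 : (X 2 : MvPowerSeries (Fin 3) κ).IsWeightedHomogeneous (Pi.single 1 1) 0 :=
    hmon _ (by simp)
  have hmul : ∀ f g : MvPowerSeries (Fin 3) κ, f.IsWeightedHomogeneous (Pi.single 1 1) 0 →
      g.IsWeightedHomogeneous (Pi.single 1 1) 0 →
      (f * g).IsWeightedHomogeneous (Pi.single 1 1) 0 := by
    intro f g hf hg
    have h : (f * g).IsWeightedHomogeneous (Pi.single 1 1) (0 + 0) := hf.mul hg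
    rwa [add_zero] at h
  have hadd : ∀ f g : MvPowerSeries (Fin 3) κ, f.IsWeightedHomogeneous (Pi.single 1 1) 0 →
      g.IsWeightedHomogeneous (Pi.single 1 1) 0 →
      (f + g).IsWeightedHomogeneous (Pi.single 1 1) 0 :=
    fun f g hf hg => hf.add hg
  have hneg : ∀ f : MvPowerSeries (Fin 3) κ, f.IsWeightedHomogeneous (Pi.single 1 1) 0 →
      (-f).IsWeightedHomogeneous (Pi.single 1 1) 0 := by
    intro f hf m hm
    rw [map_neg, neg_ne_zero] at hm
    exact hf hm
  have hpow : ∀ (f : MvPowerSeries (Fin 3) κ) (n : ℕ),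
      f.IsWeightedHomogeneous (Pi.single 1 1) 0 →
      (f ^ n).IsWeightedHomogeneous (Pi.single 1 1) 0 := by
    intro f n hf
    induction n with
    | zero => rw [pow_zero, ← monomial_zero_one]; exact hmon _ rfl
    | succ n ih => rw [pow_succ]; exact hmul _ _ ih hf
  have hW : (X 2 - X 0 - X 0 * X 2 : MvPowerSeries (Fin 3) κ).IsWeightedHomogeneous
      (Pi.single 1 1) 0 := by
    rw [sub_eq_add_neg, sub_eq_add_neg]
    exact hadd _ _ (hadd _ _ hX2 (hneg _ hX0)) (hneg _ (hmul _ _ hX0 hX2))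
  have hP : (X 0 ^ b * (X 2 - X 0 - X 0 * X 2) ^ 3 : MvPowerSeries (Fin 3) κ).IsWeightedHomogeneous
      (Pi.single 1 1) 0 :=
    hmul _ _ (hpow _ _ hX0) (hpow _ _ hW)
  refine hP.coeff_eq_zero ?_
  rwa [Finsupp.weight_single_one_apply]

/-- `ℕ → ℕ∞` commutes with `min`. [folklore] -/
theorem enat_coe_min (m n : ℕ) : ((min m n : ℕ) : ℕ∞) = min (m : ℕ∞) (n : ℕ∞) :=
  (Nat.mono_cast (α := ℕ∞)).map_min

/-- Weighted order of `P1 = x^a z^{2e} U y²`. [folklore] -/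
theorem weightedOrder_P1 (w : Fin 3 → ℕ) (a e : ℕ) {U : MvPowerSeries (Fin 3) κ}
    (hU : IsUnit U) :
    (X 0 ^ a * X 2 ^ (2 * e) * U * X 1 ^ 2 : MvPowerSeries (Fin 3) κ).weightedOrder w =
      ((a * w 0 + 2 * e * w 2 + 2 * w 1 : ℕ) : ℕ∞) := by
  rw [weightedOrder_mul, weightedOrder_mul, weightedOrder_mul, weightedOrder_pow_eq,
    weightedOrder_pow_eq, weightedOrder_pow_eq, weightedOrder_X_eq, weightedOrder_X_eq,
    weightedOrder_X_eq, weightedOrder_of_isUnit w hU]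
  push_cast
  ring

/-- Weighted order of `P2 = x^b W³`. [folklore] -/
theorem weightedOrder_P2 (w : Fin 3 → ℕ) (b : ℕ) :
    (X 0 ^ b * (X 2 - X 0 - X 0 * X 2) ^ 3 : MvPowerSeries (Fin 3) κ).weightedOrder w =
      ((b * w 0 + 3 * min (w 0) (w 2) : ℕ) : ℕ∞) := by
  rw [weightedOrder_mul, weightedOrder_pow_eq, weightedOrder_pow_eq, weightedOrder_X_eq,
    weightedOrder_W]
  push_cast
  ring

/-- The lowest `y²`-coefficient of `P1`: at `d₁ = a•e₀ + 2e•e₂ + 2•e₁` it is `U(0)`.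
[folklore] -/
theorem coeff_P1 (a e : ℕ) (U : MvPowerSeries (Fin 3) κ) :
    coeff (Finsupp.single 0 a + Finsupp.single 2 (2 * e) + Finsupp.single 1 2)
      (X 0 ^ a * X 2 ^ (2 * e) * U * X 1 ^ 2 : MvPowerSeries (Fin 3) κ) = constantCoeff U := by
  rw [X_pow_eq, X_pow_eq, X_pow_eq, monomial_mul_monomial, one_mul, coeff_mul_monomial,
    if_pos le_add_self, add_tsub_cancel_right, coeff_monomial_mul, if_pos le_rfl, tsub_self,
    one_mul, mul_one, coeff_zero_eq_constantCoeff_apply]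

/-- Weighted order of `Π = P1 − P2`: the minimum of the two (no cancellation). [folklore] -/
theorem weightedOrder_Pi (w : Fin 3 → ℕ) (a e b : ℕ) {U : MvPowerSeries (Fin 3) κ}
    (hU : IsUnit U) :
    (X 0 ^ a * X 2 ^ (2 * e) * U * X 1 ^ 2 - X 0 ^ b * (X 2 - X 0 - X 0 * X 2) ^ 3 :
        MvPowerSeries (Fin 3) κ).weightedOrder w =
      ((min (a * w 0 + 2 * e * w 2 + 2 * w 1) (b * w 0 + 3 * min (w 0) (w 2)) : ℕ) : ℕ∞) := by
  set P1 : MvPowerSeries (Fin 3) κ := X 0 ^ a * X 2 ^ (2 * e) * U * X 1 ^ 2 with hP1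
  set P2 : MvPowerSeries (Fin 3) κ := X 0 ^ b * (X 2 - X 0 - X 0 * X 2) ^ 3 with hP2
  have h1 : P1.weightedOrder w = ((a * w 0 + 2 * e * w 2 + 2 * w 1 : ℕ) : ℕ∞) :=
    weightedOrder_P1 w a e hU
  have h2 : (-P2).weightedOrder w = ((b * w 0 + 3 * min (w 0) (w 2) : ℕ) : ℕ∞) := by
    rw [weightedOrder_neg]; exact weightedOrder_P2 w b
  rw [sub_eq_add_neg]
  by_cases hne : P1.weightedOrder w ≠ (-P2).weightedOrder w
  · rw [weightedOrder_add_of_weightedOrder_ne w hne, h1, h2, enat_coe_min]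
  · rw [not_ne_iff, h1, h2] at hne
    have hne' : a * w 0 + 2 * e * w 2 + 2 * w 1 = b * w 0 + 3 * min (w 0) (w 2) := by
      exact_mod_cast hne
    apply le_antisymm
    · have hc : coeff (Finsupp.single 0 a + Finsupp.single 2 (2 * e) + Finsupp.single 1 2)
          (P1 + -P2) ≠ 0 := by
        rw [map_add, map_neg, coeff_P1, coeff_P2_eq_zero b _ (by simp), neg_zero, add_zero]
        exact (isUnit_constantCoeff U hU).ne_zero
      refine (weightedOrder_le w hc).trans (le_of_eq ?_)
      have hwt : Finsupp.weight w
          (Finsupp.single 0 a + Finsupp.single 2 (2 * e) + Finsupp.single 1 2) =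
            a * w 0 + 2 * e * w 2 + 2 * w 1 := by
        simp only [map_add, Finsupp.weight_single, smul_eq_mul]
      rw [hwt, ← hne', min_self]
    · refine le_trans ?_ (min_weightedOrder_le_add w)
      rw [h1, h2, enat_coe_min]

/-- Weighted order of the position `f = x · Π^p · E^p`. [folklore] -/
theorem weightedOrder_pos (w : Fin 3 → ℕ) (p a e b : ℕ) {U E : MvPowerSeries (Fin 3) κ}
    (hU : IsUnit U) (hE : IsUnit E) :
    (X 0 * (X 0 ^ a * X 2 ^ (2 * e) * U * X 1 ^ 2 - X 0 ^ b * (X 2 - X 0 - X 0 * X 2) ^ 3) ^ p *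
        E ^ p : MvPowerSeries (Fin 3) κ).weightedOrder w =
      ((w 0 + p * min (a * w 0 + 2 * e * w 2 + 2 * w 1) (b * w 0 + 3 * min (w 0) (w 2)) : ℕ) :
        ℕ∞) := by
  rw [weightedOrder_mul, weightedOrder_mul, weightedOrder_pow_eq, weightedOrder_pow_eq,
    weightedOrder_X_eq, weightedOrder_Pi w a e b hU, weightedOrder_of_isUnit w hE]
  push_cast
  ring

/-- STUB S9b (orders and cleanliness of positions): the `F`-orders `mF` of a position
`f = x · Π^p · E^p` for the seven centres, and: `f` is clean (no coefficient on `pℕ³`),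
non-zero,
without monomials of degree `≤ 1`. [folklore] -/
theorem stub_orders (p : ℕ) [Fact p.Prime] (κ : Type) [Field κ] [CharP κ p] (a e b : ℕ)
    (U E : MvPowerSeries (Fin 3) κ) (hU : IsUnit U) (hE : IsUnit E) :
    let f : MvPowerSeries (Fin 3) κ :=
      X 0 * (X 0 ^ a * X 2 ^ (2 * e) * U * X 1 ^ 2 - X 0 ^ b * (X 2 - X 0 - X 0 * X 2) ^ 3) ^ p *
        E ^ p
    let c : (Fin 3 → ℕ) → κ := fun A => coeff (Finsupp.equivFunOnFinite.symm A) f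
    mF Finset.univ c = 1 + p * min (a + 2 * e + 2) (b + 3) ∧
    mF {0, 2} c = 1 + p * min (a + 2 * e) (b + 3) ∧
    mF {0, 1} c = 1 + p * min (a + 2) b ∧
    mF {1, 2} c = 0 ∧
    mF {0} c = 1 + p * min a b ∧
    mF {1} c = 0 ∧
    mF {2} c = 0 ∧
    (∀ d : Fin 3 →₀ ℕ, (∀ j, p ∣ d j) → coeff d f = 0) ∧
    f ≠ 0 ∧
    (∀ d : Fin 3 →₀ ℕ, Finsupp.degree d ≤ 1 → coeff d f = 0) := by
  intro f c
  have hp : p.Prime := Fact.out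
  have key : ∀ w : Fin 3 → ℕ, f.weightedOrder w =
      ((w 0 + p * min (a * w 0 + 2 * e * w 2 + 2 * w 1) (b * w 0 + 3 * min (w 0) (w 2)) : ℕ) :
        ℕ∞) :=
    fun w => weightedOrder_pos w p a e b hU hE
  have hmF : ∀ F : Finset (Fin 3), mF F c =
      (if (0 : Fin 3) ∈ F then 1 else 0) +
        p * min (a * (if (0 : Fin 3) ∈ F then 1 else 0) +
            2 * e * (if (2 : Fin 3) ∈ F then 1 else 0) + 2 * (if (1 : Fin 3) ∈ F then 1 else 0))
          (b * (if (0 : Fin 3) ∈ F then 1 else 0) +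
            3 * min (if (0 : Fin 3) ∈ F then 1 else 0) (if (2 : Fin 3) ∈ F then 1 else 0)) :=
    fun F => mF_eq_of_weightedOrder_eq F f _ (key _)
  refine ⟨?_, ?_, ?_, ?_, ?_, ?_, ?_, ?_, ?_, ?_⟩
  · rw [hmF]; simp
  · rw [hmF]; simp
  · rw [hmF]; simp
  · rw [hmF]; simp
  · rw [hmF]; simp
  · rw [hmF]; simp
  · rw [hmF]; simp
  · intro d hd
    have hp0 : p ≠ 0 := hp.ne_zero
    show coeff d (X 0 * (X 0 ^ a * X 2 ^ (2 * e) * U * X 1 ^ 2 -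
      X 0 ^ b * (X 2 - X 0 - X 0 * X 2) ^ 3) ^ p * E ^ p) = 0
    rw [mul_assoc, ← mul_pow, X_def, coeff_monomial_mul]
    split_ifs with hle
    · rw [← map_frobenius_expand p hp0, coeff_map, coeff_expand_of_not_dvd p hp0 _ (i := 0) ?_,
        map_zero, mul_zero]
      intro hdiv
      have h0 : 1 ≤ d 0 := by simpa using hle 0
      rw [Finsupp.tsub_apply, Finsupp.single_eq_same] at hdiv
      have h1 : p ∣ d 0 - (d 0 - 1) := Nat.dvd_sub (hd 0) hdiv
      rw [Nat.sub_sub_self h0, Nat.dvd_one] at h1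
      exact hp.one_lt.ne' h1
    · rfl
  · intro h0
    have := key (fun _ => 1)
    rw [h0, weightedOrder_zero] at this
    exact ENat.top_ne_coe _ this
  · intro d hd
    apply coeff_eq_zero_of_lt_weightedOrder (fun _ => 1)
    rw [key, Nat.cast_lt]
    have hdeg : Finsupp.weight (fun _ => 1) d = Finsupp.degree d := by
      rw [Finsupp.degree_eq_weight_one]
    rw [hdeg]
    have h2 : 2 ≤ p := hp.two_le
    have hmin : 2 ≤ min (a * 1 + 2 * e * 1 + 2 * 1) (b * 1 + 3 * min 1 1) := by
      simp only [mul_one, min_self]; omega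
    nlinarith

end Summit.ResolutionOfSingularities.ResolutionOfSingularities.Theorems.ShadowGameWinR.Negative

end
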